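/-
Copyright (c) 2026 the pub-hodgecm-mathlib formalisation cell (harness21).  Prover seat hodgecm-mathlib-B-p04 (g61), req618 STAGE 1a «FOUR-FRAME» squad (director s1808;
LEAD directive v1.1 d3f1616d0136e728 D7 «B-p04 — A-0 port, then DICTIONARY SUPPORT»): the abstract fixed-coset ↔ fixed-vertex dictionary behind the census Prop (D-G)
`AnchorCountDictionary` of GATE 1a-1 (F0P3a-p01 (g30), LAWSOCKET v1.2 435f8f380eccb322 §2), over the ★ notions module `UnitaryThreeFourFrameDefs` (p854559).  2026-09-03.
-/
import Literature.NumberTheory.Automorphic.UnitaryThreeFourFrameDefs                          -- ★ p854559 (this seat): H2 `fixedVertexCount`, the sheet's tokens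
import Literature.NumberTheory.Automorphic.UnitaryLatticeTreeCentralRescalingCountTransport     -- ★ `mapGL_eq_of_coe_eq_smul` (a unit homothety of the element fixes the same lattices)
import Literature.NumberTheory.Automorphic.FixedCosetsStableLattices                            -- ★ `mem_fixedBy_quotient_mk_iff` (`gK ∈ Fix_γ ↔ g⁻¹γg ∈ K`)
import HarnessLib

/-!
# The fixed-coset ↔ fixed-vertex DICTIONARY for a group acting on the lattices of `Kᴺ` through `GL_N(K)` — `#Fix_γ(G ⧸ Stab N₀) = #{γ-fixed lattices in G·N₀}`,
# and, under transitivity on a vertex type, `= fixedVertexCount` of the four-frame census (Kottwitz 1986 §3; Rogawski 1990 §4.9 Prop. 4.9.1; Laumon 1996 Lemma (5.3.2))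

Topic `NumberTheory/Automorphic`; namespace `Literature.NumberTheory.Automorphic.UnitaryThreeFourFrame`.  THEOREMS ONLY (no definition, no instance, no notation, no named
fact, no `sorry`); datum-free (`K` any field with `Valued K ℤᵐ⁰`, any rank `N`, any form `H`, any group `G` with a hom `ι : G →* GL_N(K)`).  Cell `pub/hodgecm-mathlib`
(D-0151), crux H413 = `stmt-HodgeConjecture-24833`, organ (D-RAM) `stub_DyRamCore`, «FOUR-FRAME» road, unit (ii-G) «census dictionary»: the Prop (D-G) `AnchorCountDictionary t`
(GATE 1a-1) asserts `Φ(⟦γ⟧, 1_{K_t}) = C_t · fixedVertexCount σ_w ϖ t Γ_b` for the stabiliser `K_t` of a type-`t` vertex lattice `N` and a literal `γ` whose one-place matrix is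
`z · Γ_b` (`z ∈ E¹`).  Its proof factors as ★ `classOrbitalIntegral_indicator_complex_eq_natCard_fixedBy` (orbital integral of `1_{K_t}` = `#Fix_γ(G ⧸ K_t)`, canonical measures)
∘ THIS FILE (the group-theoretic dictionary `#Fix_γ(G ⧸ K_t) = fixedVertexCount σ ϖ t Γ`) ∘ unit (ii-0) (transitivity of `U(Φ₃)` on the type-`t` vertices, a HYPOTHESIS here).

THE MATHEMATICS ([Kottwitz1986, §3]; [Rogawski1990, §4.9 p. 55]; [Laumon1995, (4.3.11), Lemma (5.3.2)]).  Let `G` act on the `𝒪`-submodules of `Kᴺ` through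
`ι : G →* GL_N(K)` (`u · M = ι(u)·M`, ★ `mapGL`), let `N₀` be a lattice and `K_t = Stab_G(N₀)` (as a membership statement `u ∈ K_t ↔ ι(u)·N₀ = N₀`).  Then
`g K_t ↦ ι(g)·N₀` is a BIJECTION from the `γ`-fixed cosets of `G ⧸ K_t` onto the `γ`-fixed members of the orbit `G·N₀` (§1: `gK_t` is `γ`-fixed iff `g⁻¹γg ∈ K_t` iff
`γ·(g·N₀) = g·N₀`).  If `ι(G)` preserves the type-`t` vertices of the ★ lattice graph of `(Kᴺ, H)` and acts TRANSITIVELY on them (unit (ii-0)), the orbit of a type-`t`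
vertex `N₀` IS the set of type-`t` vertices, so `#Fix_γ(G ⧸ K_t) = #{type-t vertices M : γ·M = M}` (§2), which at `N = 3`, `H = Φ₃` is the sheet's census function
`fixedVertexCount σ ϖ t (ι γ)` (H2); and a unit central rescaling `ι(γ) = z·Γ`, `|z| = 1`, does not change it (★ `mapGL_eq_of_coe_eq_smul`), so it is `fixedVertexCount σ ϖ t Γ`
for the frame literal `Γ = Γ_b` of the sheet (§3) — the norm-one scalar `z` of the organ's literal `z·Γ_b` fixes every lattice.

* §0 `v_eq_one_of_mul_map_eq_one` (`z·σz = 1 ⇒ |z| = 1` under `|σ·| = |·|`), `fixedVertexCount_eq_of_coe_eq_smul`.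
* §1 `mapGL_out_eq` (coset representatives), **`mem_fixedBy_quotient_iff_mapGL_eq`**, **`exists_equiv_fixedBy_quotient_orbit`**, `natCard_fixedBy_quotient_eq_ncard_orbit`.
* §2 `setOf_orbit_fixed_eq_setOf_isVertexLattice_fixed`, **`natCard_fixedBy_quotient_eq_ncard_isVertexLattice`** (any rank, any form).
* §3 **`natCard_fixedBy_quotient_eq_fixedVertexCount`**, **`natCard_fixedBy_quotient_eq_fixedVertexCount_of_coe_eq_smul`** (`N = 3`, `Φ₃`; THE HEADS consumed by (D-G)).

NOT HERE (deliberately): the measure-theoretic half (★ `classOrbitalIntegral_indicator_complex_eq_natCard_fixedBy`), transitivity itself (unit (ii-0): `htr₀`∕`htr₂` at a wild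
datum), the CM-place instantiation `G = U(Φ₃)(L⁺_v)`, `ι = localNonsplitEquiv` (the (D-G) discharge file).  HONEST LABEL: HC_CM is proved only modulo the 7 printed citations
(2 remaining named inputs: hLiu418 = stmt-HodgeConjecture-24832, h413 = stmt-HodgeConjecture-24833) until rung 0 closes; this file is elementary bookkeeping and moves nothing.
-/

noncomputable section

open scoped Valued WithZero Matrix MatrixGroups
open Finset Classical

namespace Literature.NumberTheory.Automorphic.UnitaryThreeFourFrame

open Literature.NumberTheory.Automorphic Literature.NumberTheory.Automorphic.HermitianLattice
  Literature.NumberTheory.Automorphic.UnitaryLatticeTree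

/-! ## §0  Norm-one scalars -/

section Scalar

variable {K : Type} [Field K] [Valued K ℤᵐ⁰]

/-- A `σ`-norm-one scalar has valuation one: `z·σz = 1`, `|σa| = |a|` ⇒ `|z| = 1`. [cite: Rogawski1990, §4.9 p. 55] -/
theorem v_eq_one_of_mul_map_eq_one {σ : K →+* K} (hvσ : ∀ a, Valued.v (σ a) = Valued.v a) {z : K} (hz : z * σ z = 1) :
    Valued.v z = 1 := by
  have h : Valued.v z * Valued.v z = 1 := by
    nth_rw 2 [← hvσ z]
    rw [← map_mul, hz, map_one]
  rw [← pow_two] at h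
  exact ((pow_eq_one_iff).1 h).resolve_right two_ne_zero

/-- **The census function is blind to a unit central rescaling of the element**: `T″ = z·T` with `|z| = 1` ⇒ `fixedVertexCount σ ϖ t T″ = fixedVertexCount σ ϖ t T`
(★ `mapGL_eq_of_coe_eq_smul`: `T″·M = T·M` for every lattice `M`). [cite: Kottwitz1986, §3] [cite: Rogawski1990, §4.9 p. 55] -/
theorem fixedVertexCount_eq_of_coe_eq_smul (σ : K →+* K) (ϖ : K) (t : ℕ) {z : K} (hz : Valued.v z = 1) {T T'' : GL (Fin 3) K}
    (hTT : (T'' : Matrix (Fin 3) (Fin 3) K) = z • (T : Matrix (Fin 3) (Fin 3) K)) :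
    fixedVertexCount σ ϖ t T'' = fixedVertexCount σ ϖ t T := by
  unfold fixedVertexCount
  congr 1
  ext M
  simp only [Set.mem_setOf_eq, mapGL_eq_of_coe_eq_smul hz hTT M]

end Scalar

/-! ## §1  Fixed cosets of `G ⧸ Stab(N₀)` ↔ fixed lattices in the orbit `G·N₀` -/

section Orbit

variable {K : Type*} [Field K] [Valued K ℤᵐ⁰] {N : ℕ} {G : Type*} [Group G]
  (ι : G →* GL (Fin N) K) (N₀ : Submodule 𝒪[K] (Fin N → K)) (Kt : Subgroup G)

/-- Coset representatives: `ι(out(gK))·N₀ = ι(g)·N₀` when `K ≤ Stab(N₀)`. [cite: Laumon1995, (4.3.11) p. 83] -/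
theorem mapGL_out_eq (hKt : ∀ u : G, u ∈ Kt ↔ mapGL (ι u) N₀ = N₀) (g : G) :
    mapGL (ι ((g : G ⧸ Kt).out)) N₀ = mapGL (ι g) N₀ := by
  obtain ⟨k, hk⟩ := QuotientGroup.mk_out_eq_mul Kt g
  rw [hk, map_mul, mapGL_mul, (hKt k).1 k.2]

/-- **`gK ∈ Fix_γ(G ⧸ K) ↔ γ·(g·N₀) = g·N₀`** for `K = Stab(N₀)` (as a membership statement) — `g⁻¹γg ∈ K ↔ ι(g⁻¹γg)·N₀ = N₀ ↔ ι(γ)·ι(g)·N₀ = ι(g)·N₀`.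
[cite: Kottwitz1986, §3] [cite: Laumon1995, Lemma (5.3.2) p. 136] -/
theorem mem_fixedBy_quotient_iff_mapGL_eq (hKt : ∀ u : G, u ∈ Kt ↔ mapGL (ι u) N₀ = N₀) (γ g : G) :
    (g : G ⧸ Kt) ∈ MulAction.fixedBy (G ⧸ Kt) γ ↔ mapGL (ι γ) (mapGL (ι g) N₀) = mapGL (ι g) N₀ := by
  have e : ι g * ((ι g)⁻¹ * ι γ * ι g) = ι γ * ι g := by group
  rw [mem_fixedBy_quotient_mk_iff, hKt, map_mul, map_mul, map_inv, ← (mapGL_injective (ι g)).eq_iff, ← mapGL_mul, e, mapGL_mul]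

/-- **THE DICTIONARY `Fix_γ(G ⧸ Stab N₀) ≃ {M ∈ G·N₀ | γ·M = M}`, `gK ↦ ι(g)·N₀`** (existence form, with the value clause). [cite: Kottwitz1986, §3] [cite: Laumon1995, (4.3.11) p. 83, Lemma (5.3.2) p. 136] -/
theorem exists_equiv_fixedBy_quotient_orbit (hKt : ∀ u : G, u ∈ Kt ↔ mapGL (ι u) N₀ = N₀) (γ : G) :
    ∃ e : MulAction.fixedBy (G ⧸ Kt) γ ≃ ↥{M : Submodule 𝒪[K] (Fin N → K) | (∃ u : G, mapGL (ι u) N₀ = M) ∧ mapGL (ι γ) M = M},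
      ∀ (g : G) (h : (g : G ⧸ Kt) ∈ MulAction.fixedBy (G ⧸ Kt) γ),
        ((e ⟨(g : G ⧸ Kt), h⟩ : ↥{M : Submodule 𝒪[K] (Fin N → K) | (∃ u : G, mapGL (ι u) N₀ = M) ∧ mapGL (ι γ) M = M}) : Submodule 𝒪[K] (Fin N → K)) =
          mapGL (ι g) N₀ := by
  -- the map `q ↦ ι(out q)·N₀`
  have hval : ∀ q : G ⧸ Kt, ∀ g : G, (g : G ⧸ Kt) = q → mapGL (ι q.out) N₀ = mapGL (ι g) N₀ := by
    rintro q g rfl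
    exact mapGL_out_eq ι N₀ Kt hKt g
  have hfix : ∀ q : MulAction.fixedBy (G ⧸ Kt) γ, mapGL (ι γ) (mapGL (ι (q : G ⧸ Kt).out) N₀) = mapGL (ι (q : G ⧸ Kt).out) N₀ := by
    intro q
    have hq : (((q : G ⧸ Kt).out : G) : G ⧸ Kt) ∈ MulAction.fixedBy (G ⧸ Kt) γ := by
      rw [QuotientGroup.out_eq']; exact q.2
    exact (mem_fixedBy_quotient_iff_mapGL_eq ι N₀ Kt hKt γ _).1 hq
  let f : MulAction.fixedBy (G ⧸ Kt) γ → ↥{M : Submodule 𝒪[K] (Fin N → K) | (∃ u : G, mapGL (ι u) N₀ = M) ∧ mapGL (ι γ) M = M} :=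
    fun q => ⟨mapGL (ι (q : G ⧸ Kt).out) N₀, ⟨(q : G ⧸ Kt).out, rfl⟩, hfix q⟩
  have hf : ∀ (g : G) (h : (g : G ⧸ Kt) ∈ MulAction.fixedBy (G ⧸ Kt) γ), ((f ⟨(g : G ⧸ Kt), h⟩ : _) : Submodule 𝒪[K] (Fin N → K)) = mapGL (ι g) N₀ :=
    fun g h => hval _ g rfl
  refine ⟨Equiv.ofBijective f ⟨?_, ?_⟩, fun g h => by rw [Equiv.ofBijective_apply]; exact hf g h⟩
  · -- injective: `ι(g)·N₀ = ι(g′)·N₀ ⇒ g′⁻¹g ∈ Stab(N₀) ⇒ gK = g′K`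
    intro q q' hqq'
    have hM : mapGL (ι (q : G ⧸ Kt).out) N₀ = mapGL (ι (q' : G ⧸ Kt).out) N₀ := congrArg Subtype.val hqq'
    apply Subtype.ext
    rw [← QuotientGroup.out_eq' (q : G ⧸ Kt), ← QuotientGroup.out_eq' (q' : G ⧸ Kt), QuotientGroup.eq, hKt, map_mul, map_inv, mapGL_mul,
      ← hM, ← mapGL_mul, inv_mul_cancel, mapGL_one]
  · -- surjective: `M = ι(u)·N₀` with `γ·M = M` comes from the `γ`-fixed coset `uK`
    rintro ⟨M, ⟨u, rfl⟩, hγM⟩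
    have hu : (u : G ⧸ Kt) ∈ MulAction.fixedBy (G ⧸ Kt) γ := (mem_fixedBy_quotient_iff_mapGL_eq ι N₀ Kt hKt γ u).2 hγM
    exact ⟨⟨(u : G ⧸ Kt), hu⟩, Subtype.ext (hf u hu)⟩

/-- **`Nat.card Fix_γ(G ⧸ Stab N₀) = #{M ∈ G·N₀ | γ·M = M}`** (`Set.ncard`; both sides `0` if infinite). [cite: Kottwitz1986, §3] [cite: Laumon1995, Lemma (5.3.2) p. 136] -/
theorem natCard_fixedBy_quotient_eq_ncard_orbit (hKt : ∀ u : G, u ∈ Kt ↔ mapGL (ι u) N₀ = N₀) (γ : G) :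
    Nat.card (MulAction.fixedBy (G ⧸ Kt) γ) = {M : Submodule 𝒪[K] (Fin N → K) | (∃ u : G, mapGL (ι u) N₀ = M) ∧ mapGL (ι γ) M = M}.ncard := by
  obtain ⟨e, -⟩ := exists_equiv_fixedBy_quotient_orbit ι N₀ Kt hKt γ
  rw [Nat.card_congr e, Nat.card_coe_set_eq]

end Orbit

/-! ## §2  Under type preservation + transitivity: the orbit is the set of type-`t` vertices -/

section Vertices

variable {K : Type*} [Field K] [Valued K ℤᵐ⁰] {N : ℕ} {G : Type*} [Group G]
  (ι : G →* GL (Fin N) K) (N₀ : Submodule 𝒪[K] (Fin N → K)) (Kt : Subgroup G) (σ : K →+* K) (ϖ : K) (H : Matrix (Fin N) (Fin N) K) (t : ℕ)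

/-- If `ι(G)·N₀` consists of type-`t` vertices and `ι(G)` is TRANSITIVE on them, the `γ`-fixed members of the orbit are the `γ`-fixed type-`t` vertices. [cite: Kottwitz1986, §3] [cite: BruhatTits1972, §10] -/
theorem setOf_orbit_fixed_eq_setOf_isVertexLattice_fixed (htype : ∀ u : G, IsVertexLattice σ ϖ H t (mapGL (ι u) N₀))
    (htr : ∀ M : Submodule 𝒪[K] (Fin N → K), IsVertexLattice σ ϖ H t M → ∃ u : G, mapGL (ι u) N₀ = M) (γ : G) :
    {M : Submodule 𝒪[K] (Fin N → K) | (∃ u : G, mapGL (ι u) N₀ = M) ∧ mapGL (ι γ) M = M} =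
      {M : Submodule 𝒪[K] (Fin N → K) | IsVertexLattice σ ϖ H t M ∧ mapGL (ι γ) M = M} := by
  ext M
  simp only [Set.mem_setOf_eq]
  constructor
  · rintro ⟨⟨u, rfl⟩, hM⟩
    exact ⟨htype u, hM⟩
  · rintro ⟨hM, hγM⟩
    exact ⟨htr M hM, hγM⟩

/-- **`Nat.card Fix_γ(G ⧸ Stab N₀) = #{type-t vertices M : γ·M = M}`** under type preservation and transitivity (any rank, any form).
[cite: Kottwitz1986, §3] [cite: Rogawski1990, §4.9 Prop. 4.9.1 (b) p. 55] [cite: Laumon1995, Lemma (5.3.2) p. 136] -/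
theorem natCard_fixedBy_quotient_eq_ncard_isVertexLattice (hKt : ∀ u : G, u ∈ Kt ↔ mapGL (ι u) N₀ = N₀)
    (htype : ∀ u : G, IsVertexLattice σ ϖ H t (mapGL (ι u) N₀))
    (htr : ∀ M : Submodule 𝒪[K] (Fin N → K), IsVertexLattice σ ϖ H t M → ∃ u : G, mapGL (ι u) N₀ = M) (γ : G) :
    Nat.card (MulAction.fixedBy (G ⧸ Kt) γ) = {M : Submodule 𝒪[K] (Fin N → K) | IsVertexLattice σ ϖ H t M ∧ mapGL (ι γ) M = M}.ncard := by
  rw [natCard_fixedBy_quotient_eq_ncard_orbit ι N₀ Kt hKt γ, setOf_orbit_fixed_eq_setOf_isVertexLattice_fixed ι N₀ σ ϖ H t htype htr γ]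

end Vertices

/-! ## §3  At `N = 3`, `H = Φ₃`: the census function `fixedVertexCount` of the sheet (H2), and the frame literal `Γ` of `z·Γ` -/

section Census

variable {K : Type} [Field K] [Valued K ℤᵐ⁰] {G : Type*} [Group G]
  (ι : G →* GL (Fin 3) K) (N₀ : Submodule 𝒪[K] (Fin 3 → K)) (Kt : Subgroup G) (σ : K →+* K) (ϖ : K) (t : ℕ)

/-- **`Nat.card Fix_γ(G ⧸ K_t) = fixedVertexCount σ ϖ t (ι γ)`** — the number of `γ`-fixed cosets of the stabiliser `K_t` of a type-`t` vertex `N₀` of `(K³, Φ₃)` is the sheet's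
census function at `ι γ`, provided `ι(G)` preserves the type-`t` vertices and is transitive on them (unit (ii-0)). [cite: Rogawski1990, §4.9 Prop. 4.9.1 (b) p. 55] [cite: Kottwitz1986, §3] -/
theorem natCard_fixedBy_quotient_eq_fixedVertexCount (hKt : ∀ u : G, u ∈ Kt ↔ mapGL (ι u) N₀ = N₀)
    (htype : ∀ u : G, IsVertexLattice σ ϖ ((StdForm.antidiagonal 3).over K) t (mapGL (ι u) N₀))
    (htr : ∀ M : Submodule 𝒪[K] (Fin 3 → K), IsVertexLattice σ ϖ ((StdForm.antidiagonal 3).over K) t M → ∃ u : G, mapGL (ι u) N₀ = M) (γ : G) :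
    Nat.card (MulAction.fixedBy (G ⧸ Kt) γ) = fixedVertexCount σ ϖ t (ι γ) := by
  rw [natCard_fixedBy_quotient_eq_ncard_isVertexLattice ι N₀ Kt σ ϖ _ t hKt htype htr γ]
  rfl

/-- **THE HEAD consumed by (D-G): `Nat.card Fix_γ(G ⧸ K_t) = fixedVertexCount σ ϖ t Γ` when `ι γ = z·Γ` with `z·σz = 1`** (`|σ·| = |·|`): the norm-one scalar of the organ's
literal `z·Γ_b` fixes every lattice, so the count is the census function at the FRAME literal `Γ = Γ_b = frameElt σ f b α β` (H8).
[cite: Rogawski1990, §4.9 Prop. 4.9.1 (b) p. 55] [cite: Kottwitz1986, §3] [cite: Laumon1995, Lemma (5.3.2) p. 136] -/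
theorem natCard_fixedBy_quotient_eq_fixedVertexCount_of_coe_eq_smul (hvσ : ∀ a, Valued.v (σ a) = Valued.v a)
    (hKt : ∀ u : G, u ∈ Kt ↔ mapGL (ι u) N₀ = N₀)
    (htype : ∀ u : G, IsVertexLattice σ ϖ ((StdForm.antidiagonal 3).over K) t (mapGL (ι u) N₀))
    (htr : ∀ M : Submodule 𝒪[K] (Fin 3 → K), IsVertexLattice σ ϖ ((StdForm.antidiagonal 3).over K) t M → ∃ u : G, mapGL (ι u) N₀ = M)
    (γ : G) {z : K} (hz : z * σ z = 1) (Γ : GL (Fin 3) K) (hγ : ((ι γ : GL (Fin 3) K) : Matrix (Fin 3) (Fin 3) K) = z • (Γ : Matrix (Fin 3) (Fin 3) K)) :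
    Nat.card (MulAction.fixedBy (G ⧸ Kt) γ) = fixedVertexCount σ ϖ t Γ := by
  rw [natCard_fixedBy_quotient_eq_fixedVertexCount ι N₀ Kt σ ϖ t hKt htype htr γ,
    fixedVertexCount_eq_of_coe_eq_smul σ ϖ t (v_eq_one_of_mul_map_eq_one hvσ hz) hγ]

end Census

end Literature.NumberTheory.Automorphic.UnitaryThreeFourFrame

end
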